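import Literature.AlgebraicGeometry.Resolution.FiniteCoverCompactification
import Literature.AlgebraicGeometry.Resolution.ChowLemmaRing
import Literature.AlgebraicGeometry.RelativeSpec.FiniteGroupQuotientGluedProperties
import Literature.AlgebraicGeometry.Motives.ProjectiveOfGeneratingSections
import HarnessLib

/-!
# Equivariant projective completion of an affine variety with a finite group action (by normalisation)

Topic `Literature/AlgebraicGeometry/Resolution`. Theorems only (no named fact, no new definition of substance).
Written by the prover seat `hodge-nonav-prover-Bx` (g19, cell `hodge-nonav`) as brick **M1-2 «EQUIVARIANT
PROJECTIVE COMPLETION»** of programme M1 (memo `PROGRAMME-M1-Bx-g19.md`) for route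
`HodgeConjecture/Q8SymplecticPowers` (crux K1Q, stmt-HodgeConjecture-24190), but route-agnostic.

**Statement** (`exists_equivariant_projective_completion`). Let `k` be a field, `U` an affine integral `k`-scheme
of finite type and `ρ` an action of a finite group `G` on `U` over `k` (the tree's `RelativeSpec.ActionOver`).
Then there is an integral PROJECTIVE `k`-scheme `N` with an action `ρN` of `G` over `k` and a `G`-EQUIVARIANT open
immersion `U ↪ N` over `k`.

**Proof** (de Jong 1996, 4.17, first half; SGA 1 V §1; all ingredients are tree theorems or Mathlib):
* the quotient `B = U/G` (the tree's glued quotient `ActionOver.glued`, Mumford AV §7: `U → B` finite, surjective,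
  `G`-invariant; `B` integral and of finite type over `k`); for affine `U` the whole of `U` is a `G`-stable
  affine open, so the chart `U/G ≅ B` shows `B` affine (`isAffine_glued_of_isAffine`);
* an immersion `θ : B ↪ ℙⁿ_k` (`ChowLemmaRing.exists_immersion_projOver`, GW §(12.15)), its scheme-theoretic
  image `Y` (integral, closed in `ℙⁿ_k`) and the OPEN immersion `B ↪ Y` (Mathlib `Scheme.Hom.toImage`);
* `N :=` Mathlib's relative normalisation (`Scheme.Hom.normalization`, Stacks 035H) of `Y` in `U → B ↪ Y`;
  `U ↪ N` is an open immersion (tree `isOpenImmersion_toNormalization`, Stacks 03GV) and `N → Y` is FINITE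
  (tree `isFinite_fromNormalization_comp_ι`, E. Noether), so `N` is proper and finite over `ℙⁿ_k`, hence
  projective (tree `Motives.isProjectiveOver_of_isFinite`, GW 13.84);
* since every `g ∈ G` acts on `U` OVER `B` (hence over `Y`), Mathlib's universal property of the normalisation
  (`normalizationDesc`, `normalization.hom_ext`) lifts `g` uniquely to an automorphism of `N` over `Y`; uniqueness
  makes `g ↦ ĝ` a homomorphism and `U ↪ N` equivariant.

Honest scope: a general construction; nothing here bears on HC.

## References

* [DeJong1996] A. J. de Jong, Smoothness, semi-stability and alterations, Publ. Math. IHÉS 83 (1996), 4.17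
  (compactifying a finite cover by normalisation).
* [SGA1] A. Grothendieck, SGA 1, Exp. V §1 (quotients by finite groups), Prop. 1.1, 1.8.
* [MumfordAV1970] D. Mumford, Abelian Varieties (1970), §7 Thm. p. 66.
* [StacksProject] The Stacks Project, Tags 035H, 03GV, 0AVK.
* [GortzWedhorn2020] U. Görtz, T. Wedhorn, Algebraic Geometry I (2nd ed.), §(12.15), Thm. 13.84.
-/

noncomputable section

open CategoryTheory CategoryTheory.Limits AlgebraicGeometry TopologicalSpace

namespace Literature.AlgebraicGeometry.Resolution

universe u

open Literature.AlgebraicGeometry.Motives Literature.AlgebraicGeometry.RelativeSpec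

/-! ## The quotient of an affine scheme is affine -/

section AffineQuotient

variable {X Y : Scheme.{u}} {r : X ⟶ Y} [Y.IsSeparated] [IsAffineHom r] {G : Type*} [Group G] [Finite G]
  (ρ : ActionOver r G)

/-- For an action over an AFFINE morphism `r`, the whole of `X` is a `G`-stable affine open.
[cite: MumfordAV1970, §7 Thm. p. 66] -/
def _root_.Literature.AlgebraicGeometry.RelativeSpec.ActionOver.stableAffineOpensTop : ρ.StableAffineOpens :=
  ⟨⊤, fun _ => Scheme.Hom.preimage_top _, by
    haveI : IsIso (Scheme.Opens.ι (⊤ : X.Opens)) :=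
      isIso_of_isOpenImmersion_of_opensRange_eq_top _ (Scheme.Opens.opensRange_ι _)
    exact inferInstance⟩

omit [Y.IsSeparated] [Finite G] in
/-- Mumford's covering hypothesis is trivial for an action over an affine morphism: every point lies in the
stable affine open `⊤`. [cite: MumfordAV1970, §7 Thm. p. 66] -/
theorem _root_.Literature.AlgebraicGeometry.RelativeSpec.ActionOver.hcov_of_isAffineHom : ∀ x : X, ∃ O : ρ.StableAffineOpens, x ∈ O.1 :=
  fun _ => ⟨ρ.stableAffineOpensTop, trivial⟩

/-- The chart `⊤/G → X/G` of the glued quotient is an isomorphism (its range contains the image of the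
surjective `X → X/G`). [cite: MumfordAV1970, §7 Thm. p. 66] -/
theorem _root_.Literature.AlgebraicGeometry.RelativeSpec.ActionOver.isIso_gluedι_top (hcov : ∀ x : X, ∃ O : ρ.StableAffineOpens, x ∈ O.1) :
    IsIso (ρ.gluedι ρ.stableAffineOpensTop) := by
  have hr : (ρ.gluedι ρ.stableAffineOpensTop).opensRange = ⊤ := by
    have h := ρ.preimage_opensRange_gluedι hcov ρ.stableAffineOpensTop
    change ρ.gluedMk hcov ⁻¹ᵁ (ρ.gluedι ρ.stableAffineOpensTop).opensRange = ⊤ at h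
    ext z
    refine ⟨fun _ => trivial, fun _ => ?_⟩
    obtain ⟨x, rfl⟩ := ρ.gluedMk_surjective hcov z
    have hx : x ∈ ρ.gluedMk hcov ⁻¹ᵁ (ρ.gluedι ρ.stableAffineOpensTop).opensRange := by
      rw [h]; trivial
    exact hx
  exact isIso_of_isOpenImmersion_of_opensRange_eq_top _ hr

/-- **The quotient `X/G` (glued form) by a finite group acting over an affine morphism to an affine base is
affine.** [cite: MumfordAV1970, §7 Thm. p. 66] -/
theorem _root_.Literature.AlgebraicGeometry.RelativeSpec.ActionOver.isAffine_glued_of_isAffine [IsAffine Y] (hcov : ∀ x : X, ∃ O : ρ.StableAffineOpens, x ∈ O.1) :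
    IsAffine ρ.glued := by
  haveI := ρ.isIso_gluedι_top hcov
  haveI : IsAffine (ρ.pieceQuot ρ.stableAffineOpensTop) :=
    isAffine_of_isAffineHom ((ρ.restrict ρ.stableAffineOpensTop.1 ρ.stableAffineOpensTop.2.1).quotientToBase)
  exact IsAffine.of_isIso (inv (ρ.gluedι ρ.stableAffineOpensTop))

end AffineQuotient

/-! ## Lifting an action over the base of a relative normalisation -/

section NormalizationLift

variable {X Y : Scheme.{u}} (f : X ⟶ Y) [QuasiCompact f] [QuasiSeparated f]

/-- **An automorphism of `X` OVER `Y` lifts to the relative normalisation of `Y` in `X`** (universal property,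
Stacks 035I): the unique endomorphism `ĝ` of `N` over `Y` with `toNormalization ∘ g = ĝ ∘ toNormalization`.
[cite: StacksProject, Tag 035I] -/
def normalizationLift (g : X ⟶ X) (hg : g ≫ f = f) : f.normalization ⟶ f.normalization :=
  f.normalizationDesc (g ≫ f.toNormalization) f.fromNormalization
    (by rw [Category.assoc, Scheme.Hom.toNormalization_fromNormalization, hg])

/-- The lift commutes with the map from `X`. [cite: StacksProject, Tag 035I] -/
@[reassoc]
theorem toNormalization_normalizationLift (g : X ⟶ X) (hg : g ≫ f = f) :
    f.toNormalization ≫ normalizationLift f g hg = g ≫ f.toNormalization :=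
  f.toNormalization_normalizationDesc _ _ _

/-- The lift is over `Y`. [cite: StacksProject, Tag 035I] -/
@[reassoc]
theorem normalizationLift_fromNormalization (g : X ⟶ X) (hg : g ≫ f = f) :
    normalizationLift f g hg ≫ f.fromNormalization = f.fromNormalization :=
  f.normalizationDesc_comp _ _ _

/-- **Uniqueness**: an endomorphism of `N` over `Y` is determined by its composite with `X → N`.
[cite: StacksProject, Tag 035I] -/
theorem normalization_endo_ext {a b : f.normalization ⟶ f.normalization}
    (hab : f.toNormalization ≫ a = f.toNormalization ≫ b) (ha : a ≫ f.fromNormalization = f.fromNormalization)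
    (hb : b ≫ f.fromNormalization = f.fromNormalization) : a = b :=
  Scheme.Hom.normalization.hom_ext f a b f.fromNormalization hab ha hb

/-- The lift of the identity is the identity. [cite: StacksProject, Tag 035I] -/
theorem normalizationLift_id (h : 𝟙 X ≫ f = f) : normalizationLift f (𝟙 X) h = 𝟙 _ :=
  normalization_endo_ext f (by rw [toNormalization_normalizationLift, Category.id_comp, Category.comp_id])
    (normalizationLift_fromNormalization f _ _) (Category.id_comp _)

/-- The lift of a composite is the composite of the lifts. [cite: StacksProject, Tag 035I] -/
theorem normalizationLift_comp (g₁ g₂ : X ⟶ X) (h₁ : g₁ ≫ f = f) (h₂ : g₂ ≫ f = f) (h₁₂ : (g₁ ≫ g₂) ≫ f = f) :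
    normalizationLift f (g₁ ≫ g₂) h₁₂ = normalizationLift f g₁ h₁ ≫ normalizationLift f g₂ h₂ :=
  normalization_endo_ext f
    (by rw [toNormalization_normalizationLift, toNormalization_normalizationLift_assoc,
      toNormalization_normalizationLift, Category.assoc])
    (normalizationLift_fromNormalization f _ _)
    (by rw [Category.assoc, normalizationLift_fromNormalization, normalizationLift_fromNormalization])

variable {G : Type*} [Group G]

/-- **An action of `G` on `X` over `Y` lifts to the relative normalisation** (as automorphisms of `N`:
`g ↦` the lift of `g`, inverse the lift of `g⁻¹`). [cite: StacksProject, Tag 035I] -/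
def _root_.Literature.AlgebraicGeometry.RelativeSpec.ActionOver.normalizationAut (ρ : ActionOver f G) (g : G) : f.normalization ≅ f.normalization where
  hom := normalizationLift f (ρ.aut g).hom (ρ.aut_comp g)
  inv := normalizationLift f (ρ.aut g⁻¹).hom (ρ.aut_comp g⁻¹)
  hom_inv_id := by
    rw [← normalizationLift_comp f _ _ _ _ (by rw [Category.assoc, ρ.aut_comp, ρ.aut_comp])]
    have h : (ρ.aut g).hom ≫ (ρ.aut g⁻¹).hom = 𝟙 X := by
      rw [← Iso.trans_hom, ← Aut.Aut_mul_def, ← map_mul, inv_mul_cancel, map_one]; rfl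
    simp only [h]
    exact normalizationLift_id f _
  inv_hom_id := by
    rw [← normalizationLift_comp f _ _ _ _ (by rw [Category.assoc, ρ.aut_comp, ρ.aut_comp])]
    have h : (ρ.aut g⁻¹).hom ≫ (ρ.aut g).hom = 𝟙 X := by
      rw [← Iso.trans_hom, ← Aut.Aut_mul_def, ← map_mul, mul_inv_cancel, map_one]; rfl
    simp only [h]
    exact normalizationLift_id f _

/-- **The lifted action** of `G` on the relative normalisation `N`, over `Y`. [cite: StacksProject, Tag 035I] -/
def _root_.Literature.AlgebraicGeometry.RelativeSpec.ActionOver.normalization (ρ : ActionOver f G) : ActionOver f.fromNormalization G where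
  aut :=
    { toFun := ρ.normalizationAut f
      map_one' := by
        ext : 1
        change normalizationLift f (ρ.aut 1).hom (ρ.aut_comp 1) = 𝟙 _
        have h : (ρ.aut 1).hom = 𝟙 X := by rw [map_one]; rfl
        simp only [h]
        exact normalizationLift_id f _
      map_mul' := fun g h => by
        ext : 1
        change normalizationLift f (ρ.aut (g * h)).hom (ρ.aut_comp (g * h)) =
          normalizationLift f (ρ.aut h).hom (ρ.aut_comp h) ≫ normalizationLift f (ρ.aut g).hom (ρ.aut_comp g)
        have hgh : (ρ.aut (g * h)).hom = (ρ.aut h).hom ≫ (ρ.aut g).hom := by rw [map_mul]; rfl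
        simp only [hgh]
        exact normalizationLift_comp f _ _ _ _ _ }
  aut_comp g := normalizationLift_fromNormalization f (ρ.aut g).hom (ρ.aut_comp g)

/-- The lifted action on `N` restricted along `X → N` is the given one (equivariance of `X → N`).
[cite: StacksProject, Tag 035I] -/
theorem _root_.Literature.AlgebraicGeometry.RelativeSpec.ActionOver.toNormalization_normalization_aut (ρ : ActionOver f G) (g : G) :
    f.toNormalization ≫ ((ρ.normalization f).aut g).hom = (ρ.aut g).hom ≫ f.toNormalization := by
  change f.toNormalization ≫ normalizationLift f (ρ.aut g).hom (ρ.aut_comp g) = _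
  exact toNormalization_normalizationLift f (ρ.aut g).hom (ρ.aut_comp g)

end NormalizationLift

/-! ## The equivariant projective completion -/

section Completion

variable {k : Type u} [Field k] (U : SchemeOver k) [IsAffine U.left] [IsIntegral U.left]
  [LocallyOfFiniteType U.hom] {G : Type*} [Group G] [Finite G] (ρ : ActionOver U.hom G)

/-- **Equivariant projective completion.** An affine integral `k`-scheme of finite type with an action of a
finite group `G` over `k` admits a `G`-equivariant open immersion over `k` into an integral PROJECTIVE `k`-scheme
with a `G`-action (the normalisation of a projective closure of `U/G` in `U`; de Jong 1996, 4.17).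
[cite: DeJong1996, 4.17, p. 72] [cite: SGA1, Exp. V, Prop. 1.8] -/
theorem exists_equivariant_projective_completion :
    ∃ (N : SchemeOver k) (ρN : ActionOver N.hom G) (ι : U ⟶ N), IsIntegral N.left ∧ IsProjectiveOver N ∧
      IsOpenImmersion ι.left ∧ ∀ g : G, (ρ.aut g).hom ≫ ι.left = ι.left ≫ (ρN.aut g).hom := by
  classical
  -- the base `Spec k` and the affine structure map
  haveI : IsAffine ((Functor.fromPUnit (Spec (CommRingCat.of k))).obj U.right) :=
    inferInstanceAs (IsAffine (Spec (CommRingCat.of k)))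
  haveI : IsAffineHom U.hom := inferInstance
  haveI : Scheme.IsSeparated (Spec (CommRingCat.of k)) := inferInstance
  haveI : ((Functor.fromPUnit (Spec (CommRingCat.of k))).obj U.right).IsSeparated :=
    inferInstanceAs (Scheme.IsSeparated (Spec (CommRingCat.of k)))
  -- §1 the quotient `B = U/G`, affine, integral, of finite type; `π : U → B` finite surjective invariant
  have hcov := ρ.hcov_of_isAffineHom
  let π : U.left ⟶ ρ.glued := ρ.gluedMk hcov
  let b : ρ.glued ⟶ Spec (CommRingCat.of k) := ρ.gluedDesc U.hom ρ.aut_comp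
  have hπb : π ≫ b = U.hom := ρ.gluedMk_gluedDesc hcov U.hom ρ.aut_comp
  haveI : IsAffine ρ.glued := ρ.isAffine_glued_of_isAffine hcov
  haveI : IsIntegral ρ.glued := ρ.isIntegral_glued hcov
  haveI : IsFinite π := ρ.isFinite_gluedMk hcov
  haveI : Surjective π := ρ.surjective_gluedMk hcov
  haveI : IsLocallyNoetherian (Spec (CommRingCat.of k)) := inferInstance
  haveI : LocallyOfFiniteType b := ρ.locallyOfFiniteType_gluedDesc_base
  -- §2 an immersion `θ : B ↪ ℙⁿ_k`, its image `Y` and the open immersion `B ↪ Y`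
  obtain ⟨n, θ, hθ, hθb⟩ := ChowLemmaRing.exists_immersion_projOver b
  haveI := hθ
  let P : SchemeOver k := ChowLemmaRing.projOver k n
  haveI : IsProper P.hom := inferInstance
  haveI : QuasiCompact (θ ≫ P.hom) := by rw [hθb]; infer_instance
  haveI : QuasiCompact θ := QuasiCompact.of_comp θ P.hom
  haveI : IsIntegral θ.image := ChowLemmaProof.isIntegral_image θ
  let Y : Scheme.{u} := θ.image
  let yk : Y ⟶ Spec (CommRingCat.of k) := θ.imageι ≫ P.hom
  haveI : LocallyOfFiniteType yk := inferInstance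
  -- the open `U₀ = image of B` in `Y` and `e : U → U₀` finite surjective
  let U₀ : Y.Opens := θ.toImage.opensRange
  let e : U.left ⟶ (U₀ : Scheme.{u}) := π ≫ θ.toImage.isoOpensRange.hom
  have he : e ≫ U₀.ι = π ≫ θ.toImage := by
    change (π ≫ θ.toImage.isoOpensRange.hom) ≫ θ.toImage.opensRange.ι = _
    rw [Category.assoc, Scheme.Hom.isoOpensRange_hom_ι]
  haveI : IsFinite e := inferInstance
  haveI : Surjective e := inferInstance
  haveI : IsIntegralHom e := inferInstance
  haveI : IsAffineHom π := inferInstance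
  haveI : QuasiCompact (e ≫ U₀.ι) := by rw [he]; infer_instance
  haveI : QuasiSeparated (e ≫ U₀.ι) := by rw [he]; infer_instance
  -- §3 the normalisation `N` of `Y` in `U → Y`
  let f : U.left ⟶ Y := e ≫ U₀.ι
  haveI : IsFinite f.fromNormalization := isFinite_fromNormalization_comp_ι U₀ e yk
  haveI : IsOpenImmersion f.toNormalization := isOpenImmersion_toNormalization e U₀.ι
  -- every `g` acts over `Y`
  have hinv : ∀ g : G, (ρ.aut g).hom ≫ f = f := fun g => by
    change (ρ.aut g).hom ≫ (π ≫ θ.toImage.isoOpensRange.hom) ≫ U₀.ι = _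
    rw [← Category.assoc, ← Category.assoc, ρ.aut_hom_gluedMk hcov g]
  let ρf : ActionOver f G := ⟨ρ.aut, hinv⟩
  let N : SchemeOver k := Over.mk (f.fromNormalization ≫ yk)
  -- §4 projectivity: `N → ℙⁿ_k` is finite and `N` is proper over `k`
  haveI : IsProper N.hom := by
    change IsProper (f.fromNormalization ≫ θ.imageι ≫ P.hom)
    infer_instance
  let rN : N ⟶ projectiveSpace n k := Over.homMk (f.fromNormalization ≫ θ.imageι) rfl
  haveI : IsFinite rN.left := by
    change IsFinite (f.fromNormalization ≫ θ.imageι)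
    infer_instance
  have hproj : IsProjectiveOver N := isProjectiveOver_of_isFinite rN
  -- §5 the lifted action and the equivariant open immersion
  have hιw : f.toNormalization ≫ N.hom = U.hom := by
    change f.toNormalization ≫ f.fromNormalization ≫ θ.imageι ≫ P.hom = U.hom
    rw [Scheme.Hom.toNormalization_fromNormalization_assoc]
    change (e ≫ U₀.ι) ≫ θ.imageι ≫ P.hom = U.hom
    rw [he, Category.assoc, Scheme.Hom.toImage_imageι_assoc, hθb, hπb]
  refine ⟨N, ⟨(ρf.normalization f).aut, fun g => ?_⟩, Over.homMk f.toNormalization hιw,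
    inferInstanceAs (IsIntegral f.normalization), hproj, inferInstanceAs (IsOpenImmersion f.toNormalization),
    fun g => ?_⟩
  · change ((ρf.normalization f).aut g).hom ≫ f.fromNormalization ≫ yk = f.fromNormalization ≫ yk
    rw [← Category.assoc, (ρf.normalization f).aut_comp g]
  · exact (ρf.toNormalization_normalization_aut f g).symm

end Completion

end Literature.AlgebraicGeometry.Resolution

end
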